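import Literature.Topology.FourManifolds.StableFramingLift
import Literature.Topology.FourManifolds.SphereMapsMissPoints
import Literature.Topology.FourManifolds.MapsToSphereNullhomotopic
import Mathlib.Geometry.Manifold.PartitionOfUnity
import Mathlib.Analysis.InnerProductSpace.Calculus
import HarnessLib

/-!
# Kervaire–Milnor's Lemma 3.5 for frames: peeling a direction off a frame in the stable range

Topic `Literature/Topology/FourManifolds`; infrastructure for the Pontryagin–Thom step of
Kervaire–Milnor, *Groups of homotopy spheres I*, Ann. of Math. 77 (1963), §3–§4 (the bounding
manifold `W = G⁻¹(y) ⊆ ℝᴺ` of Lemma 4.2 has `TW ⊕ ℝᵏ ≅ ℝᴺ`, framed by the gradients of `G`; to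
reach `TW ⊕ ℝ` one removes the gradient directions one at a time, which is Lemma 3.5, p. 509:
*"Let `ξ` be a `k`-dimensional vector space bundle over an `n`-dimensional complex, `k > n`.  If
the Whitney sum of `ξ` with a trivial bundle `ε¹` is trivial then `ξ` itself is trivial"*, proof:
*"An isomorphism `ξ ⊕ ε¹ ≈ εᵏ⁺¹` gives rise to a bundle map `f` from `ξ` to the bundle `γᵏ` of
oriented `k`-planes in `(k + 1)`-space.  Since the base space of `ξ` has dimension `n`, and since
the base space of `γᵏ` is the sphere `Sᵏ`, `k > n`, it follows that `f` is null-homotopic; and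
hence that `ξ` is trivial"*).

Here the bundles are sub-bundles of a trivial bundle `S × V` (`V` a real inner product space)
presented by continuous frames, which is how they arise in the Pontryagin–Thom argument, and the
statement proved is (`Literature.Topology.FourManifolds.exists_frame_perp_of_finrank_lt`):

> let `S` be a compact `C^∞` manifold of dimension `d` (any model with corners: boundary and
> corners allowed), `f₀, …, f_r : S → V` continuous and pointwise linearly independent, and
> `ν : S → V` continuous with `⟪fᵢ(s), ν(s)⟫` not all zero at each `s` (so that
> `ξ_s = span f(s) ∩ ν(s)ᗮ` has rank `r` and `ξ ⊕ ℝ = span f` is framed).  If `d < r` then there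
> are continuous, pointwise linearly independent `t₁, …, t_r : S → V` with `t_m(s) ∈ span f(s)`
> and `⟪t_m(s), ν(s)⟫ = 0` — a frame of `ξ`.

Proof, following Kervaire–Milnor with the null-homotopy made explicit: the coefficient vector
`a(s) = (⟪fᵢ(s), ν(s)⟫)ᵢ ∈ ℝʳ⁺¹ ∖ 0` has Gauss map `â = a/‖a‖ : S → Sʳ` (the classifying map of
the bundle map to `γʳ`).  A `C^∞` approximation `b̂` of `â` (Mathlib's partition of unity lemma
`exists_contMDiffMap_forall_mem_convex_of_local_const`, valid with boundary) is never antipodal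
to `â`, and misses a point `q` of `Sʳ` because its image has Hausdorff dimension `≤ d < r`
(the tree's `dimH_range_le_finrank_of_contMDiff`, `DisjunctionLemma.lean`, and
`le_dimH_sphere_diff_singleton`, `SphereMapsMissPoints.lean`)
(`Literature.Topology.FourManifolds.exists_sphereMap_near_missing_antipode`).  The composite of
the two transport rotations `-q ↦ b̂(s) ↦ â(s)` (the tree's `exists_rotChain`,
`StableFramingLift.lean`) is a continuous family of isometries `R_s` of `ℝʳ⁺¹` with
`R_s(-q) = â(s)`; an orthonormal basis `e₁, …, e_r` of `(-q)ᗮ` gives continuous orthonormal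
`c_m(s) = R_s e_m ⊥ â(s)`, and `t_m(s) = Σᵢ c_m(s)ᵢ fᵢ(s)` is the frame (the pattern of
`hasTangentFramingAlong_of_frame_perp`, ibid.).  No homotopy lifting and no CW structure is needed.

Everything here is proved; no definitions, no named facts.

## References

* M. Kervaire, J. Milnor, *Groups of homotopy spheres I*, Ann. of Math. (2) 77 (1963), 504–537,
  Lemmas 3.3–3.5 (p. 509) and the proof of Lemma 4.2 (p. 510). doi:10.2307/1970128
  [KervaireMilnorAnnals1963]
* M. W. Hirsch, *Differential Topology*, GTM 33 (1976), Ch. 3 §1 Prop. 1.2 (images of lower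
  dimensional manifolds are nowhere dense); Ch. 4 §2 (frames and trivial bundles). [HirschDT1976]
-/

open scoped Manifold ContDiff Topology RealInnerProductSpace ENNReal
open Set Function Module Metric

noncomputable section

namespace Literature.Topology.FourManifolds

variable {ES HS : Type*} [NormedAddCommGroup ES] [NormedSpace ℝ ES] [FiniteDimensional ℝ ES]
  [TopologicalSpace HS] (IS : ModelWithCorners ℝ ES HS)
  {S : Type*} [TopologicalSpace S] [ChartedSpace HS S] [IsManifold IS ∞ S]
  [CompactSpace S] [T2Space S] [SecondCountableTopology S]

include IS

/-! ### A smooth approximation of a sphere-valued map misses an antipode -/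

/-- **A sphere-valued map on a compact manifold of smaller dimension is close to a map missing a
point.**  Let `g : S → ℝʳ⁺¹` be continuous with `‖g‖ = 1` on a compact `C^∞` manifold `S`
(possibly with boundary or corners) of dimension `< r`.  Then there are a continuous `b : S → ℝʳ⁺¹`
with `‖b‖ = 1`, never antipodal to `g` (`b s + g s ≠ 0`), and a unit vector `p` never antipodal to
`b` (`p + b s ≠ 0`): `b` is the normalisation of a `C^∞` approximation of `g` within `1/2`
(Mathlib's `exists_contMDiffMap_forall_mem_convex_of_local_const`), whose image has Hausdorff
dimension `≤ dim S < r ≤ dimH Sʳ` (`dimH_range_le_finrank_of_contMDiff`,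
`le_dimH_sphere_diff_singleton`) and so misses a point `q = -p` (Hirsch, *Differential Topology*
(1976), Ch. 3 §1, Prop. 1.2). [cite: HirschDT1976, Ch. 3 §1, Prop. 1.2] -/
theorem exists_sphereMap_near_missing_antipode {r : ℕ} (hd : finrank ℝ ES < r)
    {g : S → EuclideanSpace ℝ (Fin (r + 1))} (hg : Continuous g) (hg1 : ∀ s, ‖g s‖ = 1) :
    ∃ (b : S → EuclideanSpace ℝ (Fin (r + 1))) (p : EuclideanSpace ℝ (Fin (r + 1))),
      Continuous b ∧ (∀ s, ‖b s‖ = 1) ∧ ‖p‖ = 1 ∧ (∀ s, p + b s ≠ 0) ∧ ∀ s, b s + g s ≠ 0 := by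
  -- 1. smooth approximation `ψ` of `g` within `1/2`, and its normalisation `b`
  obtain ⟨ψ, hψ⟩ := exists_contMDiffMap_forall_mem_convex_of_local_const (I := IS)
    (n := (⊤ : ℕ∞)) (t := fun s ↦ ball (g s) (1 / 2)) (fun s ↦ convex_ball _ _) (fun s ↦
      ⟨g s, (hg.continuousAt (x := s)).eventually_mem (ball_mem_nhds (g s) one_half_pos) |>.mono
        fun q hq ↦ by rw [mem_ball, dist_comm]; exact hq⟩)
  have hψg : ∀ s, ‖ψ s - g s‖ < 1 / 2 := fun s ↦ by rw [← dist_eq_norm]; exact hψ s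
  have hψ0 : ∀ s, ψ s ≠ 0 := fun s h0 ↦ by
    have := hψg s
    rw [h0, zero_sub, norm_neg, hg1] at this
    norm_num at this
  set b : S → EuclideanSpace ℝ (Fin (r + 1)) := fun s ↦ ‖ψ s‖⁻¹ • ψ s with hb
  have hψc : Continuous ψ := ψ.contMDiff.continuous
  have hbc : Continuous b := (hψc.norm.inv₀ fun s ↦ norm_ne_zero_iff.2 (hψ0 s)).smul hψc
  have hb1 : ∀ s, ‖b s‖ = 1 := fun s ↦ norm_smul_inv_norm (hψ0 s)
  -- `‖g - b‖ ≤ ‖g - ψ‖ + ‖ψ - b‖ = ‖g - ψ‖ + |‖ψ‖ - 1| ≤ 2‖g - ψ‖ < 1`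
  have hgb : ∀ s, ‖g s - b s‖ < 1 := by
    intro s
    have h1 : ‖ψ s - b s‖ = |‖ψ s‖ - 1| := by
      have : ψ s - b s = (‖ψ s‖ - 1) • b s := by
        rw [sub_smul, one_smul, hb]
        simp only
        rw [smul_smul, mul_inv_cancel₀ (norm_ne_zero_iff.2 (hψ0 s)), one_smul]
      rw [this, norm_smul, hb1, mul_one, Real.norm_eq_abs]
    have h2 : |‖ψ s‖ - 1| ≤ ‖ψ s - g s‖ := by
      rw [← hg1 s]; exact abs_norm_sub_norm_le _ _
    calc ‖g s - b s‖ ≤ ‖g s - ψ s‖ + ‖ψ s - b s‖ := norm_sub_le_norm_sub_add_norm_sub _ _ _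
      _ < 1 / 2 + 1 / 2 := by
        rw [h1, norm_sub_rev]
        exact add_lt_add_of_lt_of_le (hψg s) ((h2.trans_lt (hψg s)).le)
      _ = 1 := by norm_num
  -- 2. `b` is `C¹`, so its image has Hausdorff dimension `≤ dim S < r`, and misses a point `q`
  have hbsmooth : ContMDiff IS 𝓘(ℝ, EuclideanSpace ℝ (Fin (r + 1))) 1 b := by
    have hn : ContDiffOn ℝ 1 (fun x : EuclideanSpace ℝ (Fin (r + 1)) ↦ ‖x‖⁻¹ • x) {0}ᶜ :=
      fun x hx ↦ ((contDiffAt_norm ℝ hx).inv (norm_ne_zero_iff.2 hx)).smul contDiffAt_id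
        |>.contDiffWithinAt
    exact hn.contMDiffOn.comp_contMDiff (ψ.contMDiff.of_le (by exact_mod_cast le_top))
      fun s ↦ hψ0 s
  have hdim : dimH (range b) < r := by
    refine (dimH_range_le_finrank_of_contMDiff hbsmooth).trans_lt ?_
    exact_mod_cast hd
  obtain ⟨q, hq1, hqb⟩ : ∃ q : EuclideanSpace ℝ (Fin (r + 1)), ‖q‖ = 1 ∧ q ∉ range b := by
    by_contra hcon
    push Not at hcon
    have hsub : (sphere (0 : EuclideanSpace ℝ (Fin (r + 1))) 1) \
        {((spherePt r : sphere (0 : EuclideanSpace ℝ (Fin (r + 1))) 1) :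
          EuclideanSpace ℝ (Fin (r + 1)))} ⊆ range b :=
      fun x hx ↦ hcon x (by simpa using hx.1)
    have := (le_dimH_sphere_diff_singleton (spherePt r)).trans (dimH_mono hsub)
    exact (lt_irrefl _) (this.trans_lt hdim)
  refine ⟨b, -q, hbc, hb1, by rw [norm_neg, hq1], fun s h ↦ hqb ⟨s, ?_⟩, fun s ↦ ?_⟩
  · -- `-q + b s = 0` forces `b s = q`
    rw [neg_add_eq_sub, sub_eq_zero] at h
    exact h
  · rw [add_comm (b s)]
    exact add_ne_zero_of_norm_sub_lt_one (hg1 s) (hgb s)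

/-! ### The peeling lemma -/

/-- **Kervaire–Milnor's Lemma 3.5 for frames in a trivial bundle (peeling off one direction in the
stable range).**  Let `S` be a compact `C^∞` manifold of dimension `d` (any model with corners),
`V` a real inner product space, `f₀, …, f_r : S → V` continuous and linearly independent at every
point, and `ν : S → V` continuous with `⟪fᵢ(s), ν(s)⟫ ≠ 0` for some `i` at every `s`.  If `d < r`,
there are continuous `t₁, …, t_r : S → V`, linearly independent at every point, with
`t_m(s) ∈ span {fᵢ(s)}` and `⟪t_m(s), ν(s)⟫ = 0`.  (The rank-`r` bundle `ξ = span f ∩ νᗮ` with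
`ξ ⊕ ε¹ = span f` trivial is itself trivial: Kervaire–Milnor 1963, Lemma 3.5, *"k > n … it follows
that `f` is null-homotopic; and hence that `ξ` is trivial"*, the Gauss map
`â = (⟪fᵢ, ν⟫)ᵢ/‖·‖ : S → Sʳ` being homotopic to a constant through the rotations
`exists_rotChain` along `-q ↦ b̂ ↦ â` of `exists_sphereMap_near_missing_antipode`.)
[cite: KervaireMilnorAnnals1963, Lemma 3.5 (p. 509)] -/
theorem exists_frame_perp_of_finrank_lt {V : Type*} [NormedAddCommGroup V]
    [InnerProductSpace ℝ V] {r : ℕ} (hd : finrank ℝ ES < r)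
    {f : Fin (r + 1) → S → V} (hf : ∀ i, Continuous (f i))
    (hli : ∀ s, LinearIndependent ℝ fun i ↦ f i s)
    {ν : S → V} (hν : Continuous ν) (hνf : ∀ s, ∃ i, ⟪f i s, ν s⟫ ≠ 0) :
    ∃ t : Fin r → S → V, (∀ m, Continuous (t m)) ∧ (∀ s, LinearIndependent ℝ fun m ↦ t m s) ∧
      (∀ m s, t m s ∈ Submodule.span ℝ (Set.range fun i ↦ f i s)) ∧ ∀ m s, ⟪t m s, ν s⟫ = 0 := by
  classical
  -- the coefficient vector `a(s) = (⟪fᵢ s, ν s⟫)ᵢ ≠ 0` and its Gauss map `g = a/‖a‖`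
  set a : S → EuclideanSpace ℝ (Fin (r + 1)) := fun s ↦ WithLp.toLp 2 fun i ↦ ⟪f i s, ν s⟫
    with ha
  have ha_apply : ∀ s i, a s i = ⟪f i s, ν s⟫ := fun s i ↦ rfl
  have hac : Continuous a :=
    (PiLp.continuous_toLp 2 _).comp (continuous_pi fun i ↦ (hf i).inner hν)
  have ha0 : ∀ s, a s ≠ 0 := by
    intro s hs
    obtain ⟨i, hi⟩ := hνf s
    exact hi (by rw [← ha_apply, hs]; rfl)
  set g : S → EuclideanSpace ℝ (Fin (r + 1)) := fun s ↦ ‖a s‖⁻¹ • a s with hgdef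
  have hgc : Continuous g := (hac.norm.inv₀ fun s ↦ norm_ne_zero_iff.2 (ha0 s)).smul hac
  have hg1 : ∀ s, ‖g s‖ = 1 := fun s ↦ norm_smul_inv_norm (ha0 s)
  have hag : ∀ s, a s = ‖a s‖ • g s := fun s ↦ by
    rw [hgdef]
    simp only
    rw [smul_smul, mul_inv_cancel₀ (norm_ne_zero_iff.2 (ha0 s)), one_smul]
  -- the approximation `b` missing `-p`, and the transport rotations `R s` with `R s p = g s`
  obtain ⟨b, p, hbc, hb1, hp1, hpb, hbg⟩ := exists_sphereMap_near_missing_antipode IS hd hgc hg1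
  have hp0 : p ≠ 0 := norm_ne_zero_iff.1 (by rw [hp1]; exact one_ne_zero)
  set u : ℕ → S → EuclideanSpace ℝ (Fin (r + 1)) := fun j ↦
    match j with
    | 0 => fun _ ↦ p
    | 1 => b
    | _ + 2 => g with hu
  have huc : ∀ j, Continuous (u j)
    | 0 => continuous_const
    | 1 => hbc
    | _ + 2 => hgc
  have hu1 : ∀ j s, ‖u j s‖ = 1
    | 0 => fun _ ↦ hp1
    | 1 => hb1
    | _ + 2 => hg1
  have hune : ∀ j s, u j s + u (j + 1) s ≠ 0
    | 0 => hpb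
    | 1 => hbg
    | j + 2 => fun s ↦ by
        show g s + g s ≠ 0
        rw [← two_smul ℝ (g s)]
        exact smul_ne_zero two_ne_zero (norm_ne_zero_iff.1 (by rw [hg1]; exact one_ne_zero))
  obtain ⟨R, hRi, hRp, hRc⟩ := exists_rotChain u huc hu1 hune 2
  have hRp' : ∀ s, R s p = g s := fun s ↦ hRp s
  -- an orthonormal basis `e` of `pᗮ`, transported: `c m s = R s (e m)`, orthonormal and `⊥ g s`
  haveI := Fact.mk (@finrank_euclideanSpace_fin ℝ _ (r + 1))
  set K : Submodule ℝ (EuclideanSpace ℝ (Fin (r + 1))) := (ℝ ∙ p)ᗮ with hK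
  have hKrank : finrank ℝ K = r := Submodule.finrank_orthogonal_span_singleton hp0
  obtain ⟨e, he, hep⟩ : ∃ e : Fin r → EuclideanSpace ℝ (Fin (r + 1)), Orthonormal ℝ e ∧
      ∀ m, ⟪e m, p⟫ = 0 := by
    let ob : OrthonormalBasis (Fin r) ℝ K := (stdOrthonormalBasis ℝ K).reindex
      (finCongr hKrank)
    refine ⟨fun m ↦ (ob m : EuclideanSpace ℝ (Fin (r + 1))),
      K.subtypeₗᵢ.orthonormal_comp_iff.2 ob.orthonormal, fun m ↦ ?_⟩
    have hm : (ob m : EuclideanSpace ℝ (Fin (r + 1))) ∈ (ℝ ∙ p)ᗮ := (ob m).2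
    rw [Submodule.mem_orthogonal_singleton_iff_inner_right] at hm
    rw [real_inner_comm]
    exact hm
  set c : Fin r → S → EuclideanSpace ℝ (Fin (r + 1)) := fun m s ↦ R s (e m) with hc
  have hcc : ∀ m, Continuous (c m) := fun m ↦ hRc (e m)
  have hcorth : ∀ s, Orthonormal ℝ fun m ↦ c m s := by
    intro s
    rw [orthonormal_iff_ite]
    intro m m'
    rw [hc]
    simp only
    rw [hRi, ← orthonormal_iff_ite.1 he m m']
  have hcg : ∀ m s, ⟪c m s, g s⟫ = 0 := fun m s ↦ by
    rw [← hRp' s, hc]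
    simp only
    rw [hRi, hep]
  have hca : ∀ m s, ⟪c m s, a s⟫ = 0 := fun m s ↦ by
    rw [hag s, inner_smul_right, hcg, mul_zero]
  -- the frame `t m s = Σᵢ (c m s)ᵢ • fᵢ s`
  refine ⟨fun m s ↦ ∑ i, c m s i • f i s, fun m ↦ ?_, fun s ↦ ?_, fun m s ↦ ?_, fun m s ↦ ?_⟩
  · -- continuity
    refine continuous_finsetSum _ fun i _ ↦ ?_
    exact ((EuclideanSpace.proj i).continuous.comp (hcc m)).smul (hf i)
  · -- linear independence
    rw [Fintype.linearIndependent_iff]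
    intro μ hμ m
    -- regroup: `Σ_m μ_m t_m = Σ_i (Σ_m μ_m c_{m i}) fᵢ`
    have hre : ∑ i, (∑ m', μ m' * c m' s i) • f i s = 0 := by
      rw [← hμ]
      simp only [Finset.smul_sum, smul_smul, Finset.sum_smul]
      rw [Finset.sum_comm]
    have hcoef : ∀ i, ∑ m', μ m' * c m' s i = 0 :=
      Fintype.linearIndependent_iff.1 (hli s) _ hre
    have hvec : ∑ m', μ m' • c m' s = 0 := by
      ext i
      rw [WithLp.ofLp_sum, Finset.sum_apply]
      simp only [WithLp.ofLp_smul, Pi.smul_apply, smul_eq_mul]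
      exact hcoef i
    exact Fintype.linearIndependent_iff.1 (hcorth s).linearIndependent μ hvec m
  · -- in the span
    exact Submodule.sum_mem _ fun i _ ↦
      Submodule.smul_mem _ _ (Submodule.subset_span (mem_range_self i))
  · -- orthogonal to `ν`
    calc ⟪∑ i, c m s i • f i s, ν s⟫ = ∑ i, c m s i * ⟪f i s, ν s⟫ := by
          rw [sum_inner]
          simp only [real_inner_smul_left]
      _ = ⟪a s, c m s⟫ := by
          rw [PiLp.inner_apply]
          refine Finset.sum_congr rfl fun i _ ↦ ?_
          rw [ha_apply]
          simp only [RCLike.inner_apply, conj_trivial, mul_comm]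
      _ = 0 := by rw [real_inner_comm, hca]

end Literature.Topology.FourManifolds

end
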